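import Summits.BirchSwinnertonDyer.BirchSwinnertonDyer.Theorems.ManinLocalTwoThreeDatumModelChange
import Summits.BirchSwinnertonDyer.BirchSwinnertonDyer.Theorems.ManinLocalTwoThreeEvenManinKummerSquare
import Summits.BirchSwinnertonDyer.Rank1Residual.ManinAdditive.TameCellLocalTwoTorsion
import Literature.NumberTheory.DiophantineGeometry.TameAdditiveTypesAtTwoProofs
import Literature.NumberTheory.DiophantineGeometry.ConductorAdditiveProofs
import Literature.NumberTheory.EllipticCurves.RootNumberTwistProofs
import HarnessLib

/-!
# E-imc-75 on the Kodaira-`IV` half of the tame cell: `4 ∥ N`, `ord₂(Δ_min) = 4 ⟹ at most one `ℚ₂`-rational 2-division root`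

Summit `BirchSwinnertonDyer`, route `ManinLocalTwoThree` (cell bsd-f2-manin), crux C2 `ManinOddAtFour`
(stmt-BirchSwinnertonDyer-22967), the TAME cell `4 ∥ N`.  The cell law E-imc-75 `TameTwoLocal.TameCellAtMostOneLocalTwoTorsionPoint`
(typer p630862; census 215 648 / 215 648; REF1 §R54) says that on the tame cell the 2-division polynomial
`4x³ + b₂x² + 2b₄x + b₆` has at most one root in `ℚ₂`.  By `kodairaSymbolAt_of_four_dvd_conductorNorm` the tame cell is the
disjoint union of the Kodaira-`IV` cell (`ord₂(Δ_min) = 4`) and the Kodaira-`IV*` cell (`ord₂(Δ_min) = 8`).  THIS FILE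
(lead p1 gen 5) PROVES the law on the `IV` cell and reduces E-imc-75 BY NAME to its `IV*` half:

* `isLocalTwoTorsionX_unique_of_padicValInt_minimalDiscriminantInt_eq_four` — `4 ∥ N_W`, `ord₂(Δ_min) = 4 ⟹
  ∀ x y : ℚ₂` roots, `x = y`.  Proof: additive at `2` (`f₂ = 2 ≥ 2`), so the `a₁ = a₃ = 0` globally minimal companion
  `C • W = [0, a₂, 0, a₄, a₆]` exists (p620514); roots shift by `C.r`; on the companion the 2-division roots are the roots of
  the monic INTEGRAL cubic `x³ + a₂x² + a₄x + a₆`, whose discriminant is `Δ_min/16`, ODD; two distinct `ℚ₂`-roots give three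
  `ℤ₂`-roots (Vieta), two of which agree mod `2` (pigeonhole in `𝔽₂`), making the discriminant EVEN — contradiction.
* `tameCellAtMostOneLocalTwoTorsionPoint_of_IVstar` — E-imc-75 ⟸ its `IV*` half (stated inline: the same conclusion under
  `ord₂(Δ_min) = 8`), the genuinely 2-adic case (24a1, `f₂ = 3`, shows that `ord₂(Δ) = 8` alone does not suffice).

Nothing about BSD or Manin's conjecture is proved. [folklore]
-/

set_option autoImplicit false
set_option linter.dupNamespace false

noncomputable section

open scoped Classical NumberField
open WeierstrassCurve IsDedekindDomain Rat.HeightOneSpectrum Literature.NumberTheory.EllipticCurves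
open Summit.BirchSwinnertonDyer.Rank1Residual.ManinAdditive.TameTwoLocal

namespace Summit.BirchSwinnertonDyer.BirchSwinnertonDyer.Theorems.ManinLocalTwoThree

/-! ### §1 `2`-adic lemmas: roots of a monic integral cubic are integral; three of them collide mod `2` -/

/-- A root in `ℚ_p` of a monic cubic with `p`-integral coefficients is `p`-integral. [folklore] -/
theorem padic_norm_le_one_of_monic_cubic_root {p : ℕ} [Fact p.Prime] {e a₂ a₄ a₆ : ℚ_[p]} (h₂ : ‖a₂‖ ≤ 1)
    (h₄ : ‖a₄‖ ≤ 1) (h₆ : ‖a₆‖ ≤ 1) (h : e ^ 3 + a₂ * e ^ 2 + a₄ * e + a₆ = 0) : ‖e‖ ≤ 1 := by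
  by_contra hlt
  rw [not_le] at hlt
  have he3 : e ^ 3 = -(a₂ * e ^ 2 + a₄ * e + a₆) := by linear_combination h
  have hpos : 0 < ‖e‖ := lt_trans zero_lt_one hlt
  have h1 : ‖e‖ ^ 3 ≤ ‖e‖ ^ 2 := by
    calc ‖e‖ ^ 3 = ‖e ^ 3‖ := (norm_pow e 3).symm
      _ = ‖a₂ * e ^ 2 + a₄ * e + a₆‖ := by rw [he3, norm_neg]
      _ ≤ max ‖a₂ * e ^ 2 + a₄ * e‖ ‖a₆‖ := Padic.nonarchimedean _ _
      _ ≤ max (max ‖a₂ * e ^ 2‖ ‖a₄ * e‖) ‖a₆‖ := max_le_max (Padic.nonarchimedean _ _) le_rfl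
      _ ≤ max (max (‖e‖ ^ 2) ‖e‖) 1 := by
          refine max_le_max (max_le_max ?_ ?_) h₆
          · rw [norm_mul, norm_pow]; exact mul_le_of_le_one_left (by positivity) h₂
          · rw [norm_mul]; exact mul_le_of_le_one_left (norm_nonneg _) h₄
      _ = ‖e‖ ^ 2 := by
          have hsq : ‖e‖ ≤ ‖e‖ ^ 2 := by nlinarith
          rw [max_eq_left hsq, max_eq_left (le_trans hlt.le hsq)]
  have h2 : ‖e‖ ^ 2 < ‖e‖ ^ 3 := by
    calc ‖e‖ ^ 2 = 1 * ‖e‖ ^ 2 := by ring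
      _ < ‖e‖ * ‖e‖ ^ 2 := mul_lt_mul_of_pos_right hlt (by positivity)
      _ = ‖e‖ ^ 3 := by ring
  linarith

/-- Among three `2`-adic integers two are congruent modulo `2`: their difference has norm `< 1`. [folklore] -/
theorem exists_norm_sub_lt_one_of_three (x y z : ℤ_[2]) :
    ‖((x : ℚ_[2])) - y‖ < 1 ∨ ‖((x : ℚ_[2])) - z‖ < 1 ∨ ‖((y : ℚ_[2])) - z‖ < 1 := by
  have hpig : ∀ a b c : ZMod 2, a = b ∨ a = c ∨ b = c := by decide
  have key : ∀ u v : ℤ_[2], PadicInt.toZMod u = PadicInt.toZMod v → ‖((u : ℚ_[2])) - v‖ < 1 := by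
    intro u v huv
    have hker : u - v ∈ RingHom.ker (PadicInt.toZMod (p := 2)) := by
      rw [RingHom.mem_ker, map_sub, huv, sub_self]
    rw [PadicInt.ker_toZMod, IsLocalRing.mem_maximalIdeal, mem_nonunits_iff, PadicInt.isUnit_iff] at hker
    have hle : ‖u - v‖ ≤ 1 := PadicInt.norm_le_one _
    have hlt : ‖u - v‖ < 1 := lt_of_le_of_ne hle hker
    rwa [PadicInt.norm_def, PadicInt.coe_sub] at hlt
  rcases hpig (PadicInt.toZMod x) (PadicInt.toZMod y) (PadicInt.toZMod z) with h | h | h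
  · exact Or.inl (key x y h)
  · exact Or.inr (Or.inl (key x z h))
  · exact Or.inr (Or.inr (key y z h))

/-- **No monic integral cubic with ODD discriminant has two distinct roots in `ℚ₂`.**  (`x ≠ y` roots give the third root
`z = −a₂ − x − y` (Vieta), all three are `2`-integral, two agree mod `2`, and `disc = ((x−y)(x−z)(y−z))²` would be even.)
[folklore] -/
theorem root_unique_of_odd_cubicDisc {a₂ a₄ a₆ : ℤ}
    (hodd : ¬ (2 : ℤ) ∣ a₂ ^ 2 * a₄ ^ 2 - 4 * a₄ ^ 3 - 4 * a₂ ^ 3 * a₆ + 18 * a₂ * a₄ * a₆ - 27 * a₆ ^ 2)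
    {x y : ℚ_[2]} (hx : x ^ 3 + (a₂ : ℚ_[2]) * x ^ 2 + (a₄ : ℚ_[2]) * x + (a₆ : ℚ_[2]) = 0)
    (hy : y ^ 3 + (a₂ : ℚ_[2]) * y ^ 2 + (a₄ : ℚ_[2]) * y + (a₆ : ℚ_[2]) = 0) : x = y := by
  by_contra hxy
  set d : ℤ := a₂ ^ 2 * a₄ ^ 2 - 4 * a₄ ^ 3 - 4 * a₂ ^ 3 * a₆ + 18 * a₂ * a₄ * a₆ - 27 * a₆ ^ 2 with hd
  set z : ℚ_[2] := -(a₂ : ℚ_[2]) - x - y with hz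
  -- Vieta
  have hsub : (x - y) * (x ^ 2 + x * y + y ^ 2 + (a₂ : ℚ_[2]) * (x + y) + (a₄ : ℚ_[2])) = 0 := by
    linear_combination hx - hy
  have hq : x ^ 2 + x * y + y ^ 2 + (a₂ : ℚ_[2]) * (x + y) + (a₄ : ℚ_[2]) = 0 := by
    rcases mul_eq_zero.mp hsub with h | h
    · exact absurd (sub_eq_zero.mp h) hxy
    · exact h
  have hv₄ : (a₄ : ℚ_[2]) = x * y + x * z + y * z := by rw [hz]; linear_combination hq
  have hv₆ : (a₆ : ℚ_[2]) = -(x * y * z) := by rw [hz]; linear_combination hx - x * hq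
  have hv₂ : (a₂ : ℚ_[2]) = -(x + y + z) := by rw [hz]; ring
  have hdisc : ((d : ℤ) : ℚ_[2]) = ((x - y) * (x - z) * (y - z)) ^ 2 := by
    rw [hd]; push_cast; rw [hv₂, hv₄, hv₆]; ring
  -- integrality of the roots
  have ha₂ : ‖(a₂ : ℚ_[2])‖ ≤ 1 := by exact_mod_cast Padic.norm_int_le_one a₂
  have ha₄ : ‖(a₄ : ℚ_[2])‖ ≤ 1 := by exact_mod_cast Padic.norm_int_le_one a₄
  have ha₆ : ‖(a₆ : ℚ_[2])‖ ≤ 1 := by exact_mod_cast Padic.norm_int_le_one a₆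
  have hxn : ‖x‖ ≤ 1 := padic_norm_le_one_of_monic_cubic_root ha₂ ha₄ ha₆ hx
  have hyn : ‖y‖ ≤ 1 := padic_norm_le_one_of_monic_cubic_root ha₂ ha₄ ha₆ hy
  -- the three roots as `2`-adic integers; two of them agree mod `2`
  set xz : ℤ_[2] := ⟨x, hxn⟩ with hxz
  set yz : ℤ_[2] := ⟨y, hyn⟩ with hyz
  set zz : ℤ_[2] := -(a₂ : ℤ_[2]) - xz - yz with hzz
  have hzc : ((zz : ℤ_[2]) : ℚ_[2]) = z := by
    rw [hzz, hz]; push_cast; rw [hxz, hyz]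
  have hxc : ((xz : ℤ_[2]) : ℚ_[2]) = x := rfl
  have hyc : ((yz : ℤ_[2]) : ℚ_[2]) = y := rfl
  have hn1 : ‖x - y‖ ≤ 1 := by
    rw [← hxc, ← hyc, ← PadicInt.coe_sub]; exact PadicInt.norm_le_one _
  have hn2 : ‖x - z‖ ≤ 1 := by
    rw [← hxc, ← hzc, ← PadicInt.coe_sub]; exact PadicInt.norm_le_one _
  have hn3 : ‖y - z‖ ≤ 1 := by
    rw [← hyc, ← hzc, ← PadicInt.coe_sub]; exact PadicInt.norm_le_one _
  have hprod : ‖(x - y) * (x - z) * (y - z)‖ < 1 := by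
    rw [norm_mul, norm_mul]
    have h0a := norm_nonneg (x - y); have h0b := norm_nonneg (x - z); have h0c := norm_nonneg (y - z)
    rcases exists_norm_sub_lt_one_of_three xz yz zz with h | h | h
    · rw [hxc, hyc] at h
      calc ‖x - y‖ * ‖x - z‖ * ‖y - z‖ ≤ ‖x - y‖ * 1 * 1 := by gcongr
        _ < 1 := by simpa using h
    · rw [hxc, hzc] at h
      calc ‖x - y‖ * ‖x - z‖ * ‖y - z‖ ≤ 1 * ‖x - z‖ * 1 := by gcongr
        _ < 1 := by simpa using h
    · rw [hyc, hzc] at h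
      calc ‖x - y‖ * ‖x - z‖ * ‖y - z‖ ≤ 1 * 1 * ‖y - z‖ := by gcongr
        _ < 1 := by simpa using h
  have hdn : ‖((d : ℤ) : ℚ_[2])‖ < 1 := by
    rw [hdisc, norm_pow]
    have h0 := norm_nonneg ((x - y) * (x - z) * (y - z))
    nlinarith
  rw [Padic.norm_intCast_lt_one_iff] at hdn
  exact hodd (by exact_mod_cast hdn)

/-! ### §2 The `2`-division roots along a `u = 1` change of variables, and on an `a₁ = a₃ = 0` model -/

/-- A `u = 1` change of variables shifts the local 2-division roots by `r`. [Silverman AEC III.1, Table 3.1] [folklore] -/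
theorem isLocalTwoTorsionX_smul_sub_of_u_eq_one (W : WeierstrassCurve ℚ) (C : VariableChange ℚ) (hu : C.u = 1)
    {x : ℚ_[2]} (hx : IsLocalTwoTorsionX W x) : IsLocalTwoTorsionX (C • W) (x - (C.r : ℚ_[2])) := by
  unfold IsLocalTwoTorsionX at hx ⊢
  rw [variableChange_b₂, variableChange_b₄, variableChange_b₆, hu]
  simp only [inv_one]
  push_cast
  linear_combination hx

/-- On an integral model with `a₁ = a₃ = 0` the local 2-division roots are the roots of the monic cubic
`x³ + a₂x² + a₄x + a₆` (`4x³ + b₂x² + 2b₄x + b₆ = 4(x³ + a₂x² + a₄x + a₆)`). [folklore] -/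
theorem cubic_eq_zero_of_isLocalTwoTorsionX_map (M : WeierstrassCurve ℤ) (h₁ : M.a₁ = 0) (h₃ : M.a₃ = 0)
    {x : ℚ_[2]} (hx : IsLocalTwoTorsionX (M.map (Int.castRingHom ℚ)) x) :
    x ^ 3 + (M.a₂ : ℚ_[2]) * x ^ 2 + (M.a₄ : ℚ_[2]) * x + (M.a₆ : ℚ_[2]) = 0 := by
  unfold IsLocalTwoTorsionX at hx
  simp only [WeierstrassCurve.b₂, WeierstrassCurve.b₄, WeierstrassCurve.b₆, map_a₁, map_a₂, map_a₃, map_a₄, map_a₆,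
    eq_intCast, h₁, h₃, Int.cast_zero] at hx
  push_cast at hx
  linear_combination hx / 4

/-! ### §3 E-imc-75 on the Kodaira-`IV` cell -/

/-- **E-imc-75 on the `IV` cell (PROVED).**  For a globally minimal elliptic `W/ℚ` with `4 ∥ N_W` and `ord₂(Δ_min) = 4`
(Kodaira type `IV` at `2`), the 2-division polynomial `4x³ + b₂x² + 2b₄x + b₆` has at most one root in `ℚ₂`.
[cite: SilvermanATAEC1994, IV.9.4 and Table 4.1] -/
theorem isLocalTwoTorsionX_unique_of_padicValInt_minimalDiscriminantInt_eq_four (W : WeierstrassCurve ℚ)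
    [W.IsElliptic] [W.IsGloballyMinimal] (h4 : 2 ^ 2 ∣ W.conductorNorm ℤ) (h8 : ¬ 2 ^ 3 ∣ W.conductorNorm ℤ)
    (hΔ4 : padicValInt 2 W.minimalDiscriminantInt = 4) :
    ∀ x y : ℚ_[2], IsLocalTwoTorsionX W x → IsLocalTwoTorsionX W y → x = y := by
  intro x y hx hy
  -- additive reduction at `2` (`f₂ = 2`)
  set v : HeightOneSpectrum ℤ := (primesEquiv (R := ℤ)).symm ⟨2, Nat.prime_two⟩ with hvdef
  have hv : natGenerator v = 2 :=
    Literature.NumberTheory.EllipticCurves.Rat.natGenerator_primesEquiv_symm ⟨2, Nat.prime_two⟩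
  have hf : W.conductorExponent v = 2 := W.conductorExponent_eq_two_of_four_dvd_conductorNorm v hv h4 h8
  have haddZ : W.HasAdditiveReductionAt v := (W.two_le_conductorExponent_iff_holds v).mp (by omega)
  have hadd : W.HasAdditiveReductionAt ((primesEquiv (R := 𝓞 ℚ)).symm ⟨2, Nat.prime_two⟩) :=
    (W.hasAdditiveReductionAt_int_iff_ringOfIntegers ⟨2, Nat.prime_two⟩).mp haddZ
  -- the `a₁ = a₃ = 0` globally minimal companion
  obtain ⟨C, M, hu, hCW, hM1, hM3, hmin⟩ := exists_smul_eq_map_a₁_a₃_eq_zero_of_hasAdditiveReductionAt_two W hadd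
  have hx' := cubic_eq_zero_of_isLocalTwoTorsionX_map M hM1 hM3
    (hCW ▸ isLocalTwoTorsionX_smul_sub_of_u_eq_one W C hu hx)
  have hy' := cubic_eq_zero_of_isLocalTwoTorsionX_map M hM1 hM3
    (hCW ▸ isLocalTwoTorsionX_smul_sub_of_u_eq_one W C hu hy)
  -- `Δ_min(W) = Δ(M) = 16 · disc(x³ + a₂x² + a₄x + a₆)`
  set d : ℤ := M.a₂ ^ 2 * M.a₄ ^ 2 - 4 * M.a₄ ^ 3 - 4 * M.a₂ ^ 3 * M.a₆ + 18 * M.a₂ * M.a₄ * M.a₆ - 27 * M.a₆ ^ 2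
    with hd
  have hMΔ : M.Δ = 16 * d := by
    rw [hd]
    simp only [WeierstrassCurve.Δ, WeierstrassCurve.b₂, WeierstrassCurve.b₄, WeierstrassCurve.b₆, WeierstrassCurve.b₈,
      hM1, hM3]
    ring
  have hmin' : W.minimalDiscriminantInt = M.Δ := by
    have h1 : (W.minimalDiscriminantInt : ℚ) = W.Δ := cast_minimalDiscriminantInt W
    have h2 : (C • W).Δ = W.Δ := by rw [variableChange_Δ, hu]; simp
    have h3 : (C • W).Δ = (M.Δ : ℚ) := by rw [hCW, map_Δ, eq_intCast]
    exact_mod_cast (h1.trans (h2.symm.trans h3))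
  have hMΔne : M.Δ ≠ 0 := by rw [← hmin']; exact minimalDiscriminantInt_ne_zero W
  have hodd : ¬ (2 : ℤ) ∣ d := by
    rintro ⟨k, hk⟩
    have h32 : ((2 : ℕ) : ℤ) ^ 5 ∣ M.Δ := ⟨k, by rw [hMΔ, hk]; push_cast; ring⟩
    rw [padicValInt_dvd_iff] at h32
    rcases h32 with h0 | h5
    · exact hMΔne h0
    · rw [← hmin', hΔ4] at h5; omega
  -- two distinct roots are impossible
  have hxy : x - (C.r : ℚ_[2]) = y - (C.r : ℚ_[2]) := root_unique_of_odd_cubicDisc hodd hx' hy'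
  simpa using hxy

/-- **E-imc-75 ⟸ its `IV*` half** (stated inline: the tame cell with `ord₂(Δ_min) = 8`).  The `IV` half is the theorem
above; the dichotomy is `padicValInt_two_minimalDiscriminantInt_of_four_dvd_conductorNorm`.  CONDITIONAL edge. [folklore] -/
theorem tameCellAtMostOneLocalTwoTorsionPoint_of_IVstar
    (hIVstar : ∀ (W : WeierstrassCurve ℚ) [W.IsElliptic] [W.IsGloballyMinimal],
      2 ^ 2 ∣ W.conductorNorm ℤ → ¬ 2 ^ 3 ∣ W.conductorNorm ℤ → padicValInt 2 W.minimalDiscriminantInt = 8 →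
        ∀ x y : ℚ_[2], IsLocalTwoTorsionX W x → IsLocalTwoTorsionX W y → x = y) :
    TameCellAtMostOneLocalTwoTorsionPoint := by
  intro W _ _ h4 h8 x y hx hy
  rcases W.padicValInt_two_minimalDiscriminantInt_of_four_dvd_conductorNorm h4 h8 with h | h
  · exact isLocalTwoTorsionX_unique_of_padicValInt_minimalDiscriminantInt_eq_four W h4 h8 h x y hx hy
  · exact hIVstar W h4 h8 h x y hx hy

end Summit.BirchSwinnertonDyer.BirchSwinnertonDyer.Theorems.ManinLocalTwoThree

end
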